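import Mathlib
import HarnessLib
import HarnessLib.Audit
import Literature.NumberTheory.LFunctions.ZetaScrew
import Summits.RiemannHypothesis.RiemannHypothesis.Theorems.IntegerScrewDefs

/-!
# Route `IntegerScrew` — TYPED STATEMENTS for the SCREW column's PROOF-OF-DATA row (P1) (D-0040,
ladder LADDER-RH §1 row S-P): the floor constant of the nested screw matrices,
`c(M) := M · λ_min(S_M)`, its conjectured limit `1/4`, and the DERIVED trial bound with its second
term `a′ = (2 − γ)/4 − (log 2)/6 + 3ζ′(2)/(2π²) = 0.0976813…`

The objects and claims are those of the A6 lineage C (rh-explicit-screw-matvec-1 gen9–gen12: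
HOME `ANATOMY-C-INFINITY.md` §4–§11, `TRIAL-BOUND-THEOREM.md`, `SECOND-ORDER-THEORY.md`; the
typed scratch is screw-matvec-1 gen10's, filed here by the column's theory seat pivot-theory-1 gen18
with two additions, `ScrewFloorLimsupQuarter` and `ScrewFloorSecondOrderLaw`).  This file only NAMES
the objects and STATES the claims as `Prop`s in the tree's vocabulary (`screwMatrix`, `zetaScrew`),
so that the column can point at exact statements; nothing here is proved about `ζ`.

LABELS (ladder rule §5.4).  Every `Prop` below is a statement about SIZES of an RH-consequence
quantity: under RH all of them are meaningful and `ScrewFloorTrialBound` / `ScrewFloorLimsupQuarter`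
are DERIVED (paper) there; WITHOUT RH they hold trivially (`c(M) < 0` for all large `M`, by
`DiscreteLandau` + nestedness).  So they are RH-FREE IN KIND (a closed form for `c_∞` is not RH
content); the only RH-EQUIVALENT statement in this circle is `∀ M ≥ 2, 0 < c(M)` (with `S_1`), which
is `riemannHypothesis_iff_screwMatrix_posDef` re-indexed and is NOT asserted here.  Nothing here
bears on the truth of RH.

* `screwRayleigh M v`  — `vᵀ S_M v / vᵀ v` for `v : Fin (M-1) → ℝ` (`S_M = screwMatrix (M - 1)`).
* `screwFloor M`       — `c(M) := M · inf_{v ≠ 0} screwRayleigh M v` (the numbers of record of the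
  A6 track: `c(2^20·1000/1024…) ≈ 0.2533`; `= M · λ_min(S_M)`).
* `screwFloorFirstOrderConst` — `a′ := (2 − γ)/4 − (log 2)/6 + 3 ζ′(2)/(2π²)`.
* `screwTrialConst`, `screwTrialConstSharp` — `e₀′ := 1/4 − (log 2)/6 + 3ζ′(2)/(2π²)` and
  `e₀ := e₀′ + Z₂/4`, `Z₂ := Σ_{ρ, Im ρ > 0} 2/(Im ρ)²` (stated via `riemannZeta` zeros).
* `ScrewFloorTrialBound` (THEOREM B of TRIAL-BOUND-THEOREM.md, derived, not formalised):
  `∀ ε > 0, eventually c(M) ≤ 1/4 + (a′ + ε)/log M`.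
* `ScrewFloorQuarterLimit` (CONJECTURE): `c(M) → 1/4`.
* `ScrewFloorLaw` (CONJECTURE C, PRED-C15): `c(M) = 1/4 + a′/log M + O(1/log² M)`.
-/

noncomputable section

-- D-0017: `Summit.<S>.<S>.…` is the designed namespace of a single-problem summit.
set_option linter.dupNamespace false

namespace Summit.RiemannHypothesis.RiemannHypothesis.Theorems.IntegerScrew

open Literature.NumberTheory.LFunctions Matrix Filter
open scoped BigOperators Topology

/-- The Rayleigh quotient `vᵀ S_M v / vᵀ v` of the screw Gram matrix `S_M = screwMatrix (M − 1)`
(value `0` at `v = 0` by `x / 0 = 0`). [folklore] -/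
def screwRayleigh (M : ℕ) (v : Fin (M - 1) → ℝ) : ℝ :=
  (v ⬝ᵥ ((screwMatrix (M - 1)).mulVec v)) / (v ⬝ᵥ v)

/-- The FLOOR CONSTANT `c(M) := M · inf_{v ≠ 0} vᵀ S_M v / vᵀ v = M · λ_min(S_M)` of the A6 track
(lineages A/B/C: `c(M) ∈ [0.2502, 0.2534]` for `10³ ≤ M ≤ 4·10⁶`; RH ⇔ `c(M) > 0` for all `M ≥ 2`
together with `S_1`). [folklore] -/
def screwFloor (M : ℕ) : ℝ :=
  (M : ℝ) * sInf {q : ℝ | ∃ v : Fin (M - 1) → ℝ, v ≠ 0 ∧ q = screwRayleigh M v}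

/-- `a′ := (2 − γ)/4 − (log 2)/6 + 3ζ′(2)/(2π²) = 0.0976813…`, the DERIVED first-order constant of the
Euler-ended eta trial vector (ANATOMY §9(e); PRED-C14-A1). [folklore] -/
def screwFloorFirstOrderConst : ℝ :=
  (2 - Real.eulerMascheroniConstant) / 4 - Real.log 2 / 6
    + 3 * (deriv riemannZeta 2).re / (2 * Real.pi ^ 2)

/-- `e₀′ := 1/4 − (log 2)/6 + 3ζ′(2)/(2π²) = −0.0080147…`: the constant term of
`M · xᵀ S_M x = (log M)/4 + e₀′ + o(1)` for the Euler-ended eta vector (ANATOMY §9(e)). [folklore] -/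
def screwTrialConst : ℝ :=
  1 / 4 - Real.log 2 / 6 + 3 * (deriv riemannZeta 2).re / (2 * Real.pi ^ 2)

/-- `Z₂ := Σ_{ρ : ζ(ρ) = 0, 0 < Re ρ < 1, Im ρ > 0} 2/(Im ρ)²` (`= 0.0462099862…` on RH), as a `tsum`
over the subtype of nontrivial zeros in the upper half plane. [folklore] -/
def zetaZeroImSqSum : ℝ :=
  ∑' ρ : {s : ℂ // riemannZeta s = 0 ∧ 0 < s.re ∧ s.re < 1 ∧ 0 < s.im}, 2 / (ρ : ℂ).im ^ 2

/-- `e₀ := e₀′ + Z₂/4 = 0.0035377…`: the constant term for the SHARPLY ended eta vector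
(ANATOMY §9(b); PRED-C14). [folklore] -/
def screwTrialConstSharp : ℝ :=
  screwTrialConst + zetaZeroImSqSum / 4

/-- THEOREM B of `TRIAL-BOUND-THEOREM.md` (DERIVED under RH from the explicit formula, the approximate
functional equation at the zeros, Landau–Gonek and Riemann–von Mangoldt; unconditional by
`DiscreteLandau`; NOT formalised): for every `ε > 0`, eventually
`c(M) ≤ 1/4 + (a′ + ε)/log M`. [folklore] -/
@[conjecture] def ScrewFloorTrialBound : Prop :=
  ∀ ε : ℝ, 0 < ε → ∀ᶠ M : ℕ in atTop,
    screwFloor M ≤ 1 / 4 + (screwFloorFirstOrderConst + ε) / Real.log M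

/-- CONJECTURE (A6 lineage C, ANATOMY §4/§8: `ψ(2)/12 = 1/4`): `c(M) → 1/4`. [folklore] -/
@[conjecture] def ScrewFloorQuarterLimit : Prop :=
  Tendsto (fun M : ℕ => screwFloor M) atTop (𝓝 (1 / 4))

/-- CONJECTURE C (PRED-C15): `c(M) = 1/4 + a′/log M + O(1/log² M)`, i.e. the trial bound's first two
orders are sharp. [folklore] -/
@[conjecture] def ScrewFloorLaw : Prop :=
  ∃ C : ℝ, ∀ᶠ M : ℕ in atTop,
    |screwFloor M - 1 / 4 - screwFloorFirstOrderConst / Real.log M| ≤ C / Real.log M ^ 2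

/-- The law implies the limit: `C/log² M → 0` and `a′/log M → 0`. [folklore] -/
theorem screwFloorQuarterLimit_of_law (h : ScrewFloorLaw) : ScrewFloorQuarterLimit := by
  obtain ⟨C, hC⟩ := h
  have hlog : Tendsto (fun M : ℕ => Real.log (M : ℝ)) atTop atTop :=
    Real.tendsto_log_atTop.comp tendsto_natCast_atTop_atTop
  have h1 : Tendsto (fun M : ℕ => screwFloorFirstOrderConst / Real.log (M : ℝ)) atTop (𝓝 0) :=
    tendsto_const_nhds.div_atTop hlog
  have h2 : Tendsto (fun M : ℕ => C / Real.log (M : ℝ) ^ 2) atTop (𝓝 0) :=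
    tendsto_const_nhds.div_atTop (tendsto_pow_atTop two_ne_zero |>.comp hlog)
  have h2' : Tendsto (fun M : ℕ => -(C / Real.log (M : ℝ) ^ 2)) atTop (𝓝 0) := by
    simpa using h2.neg
  -- squeeze `screwFloor M − 1/4 − a′/log M` between `∓ C/log² M`
  have h3 : Tendsto (fun M : ℕ => screwFloor M - 1 / 4 - screwFloorFirstOrderConst / Real.log (M : ℝ))
      atTop (𝓝 0) := by
    refine tendsto_of_tendsto_of_tendsto_of_le_of_le' h2' h2 ?_ ?_
    · filter_upwards [hC] with M hM
      exact neg_le_of_abs_le hM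
    · filter_upwards [hC] with M hM
      exact le_of_abs_le hM
  have h4 : Tendsto (fun M : ℕ => (screwFloor M - 1 / 4 - screwFloorFirstOrderConst / Real.log (M : ℝ))
      + screwFloorFirstOrderConst / Real.log (M : ℝ) + 1 / 4) atTop (𝓝 (0 + 0 + 1 / 4)) :=
    (h3.add h1).add tendsto_const_nhds
  simp only [zero_add] at h4
  refine h4.congr' (Eventually.of_forall fun M => ?_)
  ring

/-- THEOREM A of `TRIAL-BOUND-THEOREM.md` (the leading order of the trial bound; DERIVED on paper,
not formalised): `limsup_M c(M) ≤ 1/4`, in the `ε`-form `∀ ε > 0, eventually c(M) ≤ 1/4 + ε`.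
Under RH this is the eta trial vector; without RH it is trivial (`c(M) < 0` eventually).  RH-FREE in
kind (a statement about the size of the margin, not its sign). [folklore] -/
@[conjecture] def ScrewFloorLimsupQuarter : Prop :=
  ∀ ε : ℝ, 0 < ε → ∀ᶠ M : ℕ in atTop, screwFloor M ≤ 1 / 4 + ε

/-- CONJECTURE C′ (the SECOND-ORDER floor law of `SECOND-ORDER-THEORY.md` §3, screw-matvec-1 gen12;
the coefficient `b` is DERIVED there as the value `b* = −0.738 ± 0.005` of an explicit
one-dimensional extremal problem, not a closed form, so it is quantified existentially here):
`c(M) = 1/4 + a′/log M + b/log² M + O(1/log³ M)`.  This is the law the SCREW column's DATA rung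
S-D(b) («fit-free acceleration of certified c(2^k)») tests. [folklore] -/
@[conjecture] def ScrewFloorSecondOrderLaw : Prop :=
  ∃ b C : ℝ, ∀ᶠ M : ℕ in atTop,
    |screwFloor M - 1 / 4 - screwFloorFirstOrderConst / Real.log M - b / Real.log M ^ 2|
      ≤ C / Real.log M ^ 3

/-- The trial bound implies `limsup c(M) ≤ 1/4`: `(a′ + 1)/log M ≤ ε` eventually. [folklore] -/
theorem screwFloorLimsupQuarter_of_trialBound (h : ScrewFloorTrialBound) :
    ScrewFloorLimsupQuarter := by
  intro ε hε
  have hlog : Tendsto (fun M : ℕ => Real.log (M : ℝ)) atTop atTop :=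
    Real.tendsto_log_atTop.comp tendsto_natCast_atTop_atTop
  have h1 : Tendsto (fun M : ℕ => (screwFloorFirstOrderConst + 1) / Real.log (M : ℝ)) atTop (𝓝 0) :=
    tendsto_const_nhds.div_atTop hlog
  have h2 : ∀ᶠ M : ℕ in atTop, (screwFloorFirstOrderConst + 1) / Real.log (M : ℝ) ≤ ε :=
    (h1.eventually (ge_mem_nhds hε))
  filter_upwards [h 1 one_pos, h2] with M hM hM2
  exact hM.trans (by linarith)

/-- The second-order law implies the first-order law (`|b|/log² M + C/log³ M ≤ (|b| + |C|)/log² M`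
once `log M ≥ 1`). [folklore] -/
theorem screwFloorLaw_of_secondOrderLaw (h : ScrewFloorSecondOrderLaw) : ScrewFloorLaw := by
  obtain ⟨b, C, hC⟩ := h
  refine ⟨|b| + |C|, ?_⟩
  have hlog : Tendsto (fun M : ℕ => Real.log (M : ℝ)) atTop atTop :=
    Real.tendsto_log_atTop.comp tendsto_natCast_atTop_atTop
  filter_upwards [hC, hlog.eventually (eventually_ge_atTop 1)] with M hM hL
  have hL0 : 0 < Real.log (M : ℝ) := by linarith
  have hL2 : 0 < Real.log (M : ℝ) ^ 2 := by positivity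
  have hL3 : Real.log (M : ℝ) ^ 2 ≤ Real.log (M : ℝ) ^ 3 := by
    calc Real.log (M : ℝ) ^ 2 = Real.log (M : ℝ) ^ 2 * 1 := by ring
      _ ≤ Real.log (M : ℝ) ^ 2 * Real.log (M : ℝ) := by gcongr
      _ = Real.log (M : ℝ) ^ 3 := by ring
  have hb : |b / Real.log (M : ℝ) ^ 2| = |b| / Real.log (M : ℝ) ^ 2 := by
    rw [abs_div, abs_of_pos hL2]
  have hCle : C / Real.log (M : ℝ) ^ 3 ≤ |C| / Real.log (M : ℝ) ^ 2 :=
    calc C / Real.log (M : ℝ) ^ 3 ≤ |C| / Real.log (M : ℝ) ^ 3 := by gcongr; exact le_abs_self C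
      _ ≤ |C| / Real.log (M : ℝ) ^ 2 := by gcongr
  calc |screwFloor M - 1 / 4 - screwFloorFirstOrderConst / Real.log (M : ℝ)|
      = |(screwFloor M - 1 / 4 - screwFloorFirstOrderConst / Real.log (M : ℝ)
            - b / Real.log (M : ℝ) ^ 2) + b / Real.log (M : ℝ) ^ 2| := by ring_nf
    _ ≤ |screwFloor M - 1 / 4 - screwFloorFirstOrderConst / Real.log (M : ℝ)
            - b / Real.log (M : ℝ) ^ 2| + |b / Real.log (M : ℝ) ^ 2| := abs_add_le _ _
    _ ≤ C / Real.log (M : ℝ) ^ 3 + |b| / Real.log (M : ℝ) ^ 2 := by rw [hb]; gcongr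
    _ ≤ |C| / Real.log (M : ℝ) ^ 2 + |b| / Real.log (M : ℝ) ^ 2 := by gcongr
    _ = (|b| + |C|) / Real.log (M : ℝ) ^ 2 := by ring

/-! ## ERRATUM (pivot-theory-1 gen18, 2026-08-25; rh-columns-ref1 GAP-NOTE p-n1, cycle 6) — RH LABELS

The module docstring above is WRONG in two places and must not be quoted for labels:
(i) «RH-FREE IN KIND … WITHOUT RH they hold trivially» is true ONLY for the two UPPER statements
`ScrewFloorTrialBound` and `ScrewFloorLimsupQuarter`.  The three statements `ScrewFloorQuarterLimit`
(`c(M) → 1/4`), `ScrewFloorLaw` and `ScrewFloorSecondOrderLaw` each force `0 < c(M)` for all large `M`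
and are therefore of RH STRENGTH: each IMPLIES RH (kernel proofs `riemannHypothesis_of_screwFloorQuarterLimit`,
`…_of_screwFloorLaw`, `…_of_screwFloorSecondOrderLaw` in `IntegerScrewFloorConstantRH`, staged,
farm-checked, filing when this module's olean exists), while RH is known to give back only `0 < c(M)`;
as conjectures they read «RH ∧ the flat eta direction is asymptotically extremal».
(ii) «the only RH-EQUIVALENT statement in this circle is ∀ M ≥ 2, 0 < c(M)» misses that EVENTUAL
positivity is already RH-equivalent: `RH ↔ ∀ M ≥ 2, 0 < c(M) ↔ (0 < c(M) for all large M)`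
(`riemannHypothesis_iff_screwFloor_pos_two_le`, `riemannHypothesis_iff_eventually_screwFloor_pos`,
same staged file; nestedness + Suzuki2023 Thm 1.1).  There is no slack rung below RH on the lower side.
Labels of record (SCREW-THEORY-R1.md §1, ref1 cycle 6 PASS): TrialBound / LimsupQuarter = RH-FREE;
QuarterLimit / Law / SecondOrderLaw = RH-STRENGTH.  Nothing in this file bears on the truth of RH. -/

end Summit.RiemannHypothesis.RiemannHypothesis.Theorems.IntegerScrew
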